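import Summits.Langlands.Langlands.Theses.PicardMuOrdinary
import Summits.Langlands.Langlands.Theorems.MuOrdinaryFamilyRT.Negative.CongruenceEncoding

/-!
# `MuOrdinaryFamilyRT`: parity shadow — the approximants cannot be conjugate self-dual

Negative-side lemmas of the standing disprover of the crux
`Summit.Langlands.Langlands.Theses.PicardMuOrdinary.MuOrdinaryFamilyRT` (item stmt-Langlands-13757),
cycle 3; they answer the PARITY NOTE of the 13758 planner (evidence on the item, 2026-08-16T02:37Z).

The conclusion of the crux encodes "`t ≡ 0 (mod 3^k ℤ̄_𝔐)`" as `∃ u, u ∉ 𝔐 ∧ u * t ∈ span {3 ^ k}`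
(faithful and strictly nested: `Negative/CongruenceEncoding.lean`).  The Picard representation is
polarised with an ODD-POWER multiplier, `ρ_C^c ≅ ρ_C^∨ ⊗ ε^{∓1}` (Weil pairing on `H¹(C)` pairs the
two `ℤ[ω]`-isotypic parts with each other), whereas the Galois representation of an EXACTLY conjugate
self-dual regular algebraic cuspidal `Π` on `GL₃/K` has `r(Π)^c ≅ r(Π)^∨ ⊗ ε^{-2}`.  Were the `P_k` of
the conclusion such `Π`, trace convergence at all unramified `𝔭` (hence convergence of characteristic
polynomials, losing one power of `3` in `e₃ = (p₁³ − 3p₁p₂ + 2p₃)/6`) would force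
`ρ_C ≅ ρ_C ⊗ ε^{j}`, `j ∈ {1, 3}`, modulo every `3^{k-1}`, and at `Frob_𝔭` this reads
`a_𝔭(f) · (1 − N𝔭^{j}) ≡ 0 (mod 3^{k-1} ℤ̄_𝔐)`.  By Chebotarev in `K(ζ₉, f)` there are `𝔭` with
`N𝔭 ≡ 4, 7 (mod 9)` and `a_𝔭 ∉ 𝔐` (`a_𝔭 ≡ #roots − 1 mod λ`, choose `#roots ∈ {0, 2}`), and then the
left side has valuation exactly `1 + v₃(j) ≤ 2`: the lemmas below.  So "conjugate self-dual `P_k`"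
is unsatisfiable from level `k = 4` on; the crux as typed imposes no self-duality and is unaffected; a
polarised restatement must use the ESSENTIALLY self-dual normal form (twist by an algebraic Hecke
character), as that planner proposes.

* `not_cong_succ_three_pow_mul` — `3ⁿ · v`, `v ∉ 𝔐`, is not at level `n + 1`;
* `one_sub_natCast_eq_three_mul` — `q ≡ 4, 7 (mod 9)` ⇒ `1 − q = 3 w` with `w ∉ 𝔐`;
* `not_cong_two_mul_one_sub_natCast` — `a ∉ 𝔐` ⇒ `a (1 − q)` is not at level `2`;
* `not_cong_three_mul_one_sub_natCast_pow_three` — `a (1 − q³)` is not at level `3`.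
-/

set_option linter.dupNamespace false -- project-wide option (lakefile weak.linter.dupNamespace); `Summit.Langlands.Langlands` is the mandated namespace

namespace Summit.Langlands.Langlands.Theorems.MuOrdinaryFamilyRT.Negative

/-- `3ⁿ · v` with `v ∉ 𝔐` is NOT `≡ 0 (mod 3ⁿ⁺¹ ℤ̄_𝔐)` (`v_𝔐(3ⁿ v) = n`). [folklore] -/
theorem not_cong_succ_three_pow_mul {𝔐 : Ideal (integralClosure ℤ ℂ)} (h𝔐 : 𝔐.IsPrime)
    (h3 : (3 : integralClosure ℤ ℂ) ∈ 𝔐) {v : integralClosure ℤ ℂ} (hv : v ∉ 𝔐) (n : ℕ) :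
    ¬ ∃ u, u ∉ 𝔐 ∧ u * (3 ^ n * v) ∈ Ideal.span {(3 : integralClosure ℤ ℂ) ^ (n + 1)} := by
  rintro ⟨u, hu, hmem⟩
  obtain ⟨w, hw⟩ := Ideal.mem_span_singleton.mp hmem
  have key : u * v = 3 * w := by
    apply mul_left_cancel₀ (pow_ne_zero n three_ne_zero_integralClosure)
    linear_combination hw
  have hmem' : u * v ∈ 𝔐 := by
    rw [key]; exact Ideal.mul_mem_right w 𝔐 h3
  exact (h𝔐.mem_or_mem hmem').elim hu hv

/-- For `q ≡ 4` or `7 (mod 9)`: `1 − q = 3 · w` with `w ∉ 𝔐`. [folklore] -/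
theorem one_sub_natCast_eq_three_mul {𝔐 : Ideal (integralClosure ℤ ℂ)} (h𝔐 : 𝔐.IsPrime)
    (h3 : (3 : integralClosure ℤ ℂ) ∈ 𝔐) {q : ℕ} (hq : q % 9 = 4 ∨ q % 9 = 7) :
    ∃ w : integralClosure ℤ ℂ, (1 - (q : integralClosure ℤ ℂ)) = 3 * w ∧ w ∉ 𝔐 := by
  have hq9 : (q : integralClosure ℤ ℂ) =
      9 * ((q / 9 : ℕ) : integralClosure ℤ ℂ) + ((q % 9 : ℕ) : integralClosure ℤ ℂ) := by
    exact_mod_cast (Nat.div_add_mod q 9).symm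
  have hne : 𝔐 ≠ ⊤ := h𝔐.ne_top
  have aux : ∀ (m : integralClosure ℤ ℂ) (r : ℕ), r = 1 ∨ r = 2 →
      -(3 * m + (r : integralClosure ℤ ℂ)) ∉ 𝔐 := by
    intro m r hr hmem
    have hpos : 3 * m + (r : integralClosure ℤ ℂ) ∈ 𝔐 := by simpa using 𝔐.neg_mem_iff.mp hmem
    have h3m : 3 * m ∈ 𝔐 := Ideal.mul_mem_right m 𝔐 h3
    have hr𝔐 : (r : integralClosure ℤ ℂ) ∈ 𝔐 := by simpa using Ideal.sub_mem 𝔐 hpos h3m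
    apply hne
    rw [Ideal.eq_top_iff_one]
    rcases hr with rfl | rfl
    · simpa using hr𝔐
    · have : (3 : integralClosure ℤ ℂ) - 2 ∈ 𝔐 := Ideal.sub_mem 𝔐 h3 (by simpa using hr𝔐)
      norm_num at this
      exact this
  rcases hq with h | h
  · refine ⟨-(3 * ((q / 9 : ℕ) : integralClosure ℤ ℂ) + ((1 : ℕ) : integralClosure ℤ ℂ)), ?_,
      aux _ 1 (Or.inl rfl)⟩
    rw [hq9, h]; push_cast; ring
  · refine ⟨-(3 * ((q / 9 : ℕ) : integralClosure ℤ ℂ) + ((2 : ℕ) : integralClosure ℤ ℂ)), ?_,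
      aux _ 2 (Or.inr rfl)⟩
    rw [hq9, h]; push_cast; ring

/-- **Parity shadow, level 2**: for `a ∉ 𝔐` and `q ≡ 4, 7 (mod 9)`, `a · (1 − q)` is NOT
`≡ 0 (mod 3² ℤ̄_𝔐)` — the trace at `Frob_𝔭` (`q = N𝔭`, `a = e(a_𝔭(f))`) of the impossible
congruence `ρ_C ≡ ρ_C ⊗ ε (mod 3²)`. [folklore] -/
theorem not_cong_two_mul_one_sub_natCast {𝔐 : Ideal (integralClosure ℤ ℂ)} (h𝔐 : 𝔐.IsPrime)
    (h3 : (3 : integralClosure ℤ ℂ) ∈ 𝔐) {a : integralClosure ℤ ℂ} (ha : a ∉ 𝔐) {q : ℕ}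
    (hq : q % 9 = 4 ∨ q % 9 = 7) :
    ¬ ∃ u, u ∉ 𝔐 ∧ u * (a * (1 - (q : integralClosure ℤ ℂ))) ∈
        Ideal.span {(3 : integralClosure ℤ ℂ) ^ 2} := by
  obtain ⟨w, hw, hw𝔐⟩ := one_sub_natCast_eq_three_mul h𝔐 h3 hq
  have haw : a * w ∉ 𝔐 := fun h => (h𝔐.mem_or_mem h).elim ha hw𝔐
  have : a * (1 - (q : integralClosure ℤ ℂ)) = 3 ^ 1 * (a * w) := by rw [hw]; ring
  rw [this]
  exact not_cong_succ_three_pow_mul h𝔐 h3 haw 1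

/-- **Parity shadow, level 3**: for `a ∉ 𝔐` and `q ≡ 4, 7 (mod 9)`, `a · (1 − q³)` is NOT
`≡ 0 (mod 3³ ℤ̄_𝔐)` (`1 − q³ = (1 − q)(1 + q + q²)`, both factors of `𝔐`-valuation exactly `1`).
[folklore] -/
theorem not_cong_three_mul_one_sub_natCast_pow_three {𝔐 : Ideal (integralClosure ℤ ℂ)}
    (h𝔐 : 𝔐.IsPrime) (h3 : (3 : integralClosure ℤ ℂ) ∈ 𝔐) {a : integralClosure ℤ ℂ} (ha : a ∉ 𝔐)
    {q : ℕ} (hq : q % 9 = 4 ∨ q % 9 = 7) :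
    ¬ ∃ u, u ∉ 𝔐 ∧ u * (a * (1 - (q : integralClosure ℤ ℂ) ^ 3)) ∈
        Ideal.span {(3 : integralClosure ℤ ℂ) ^ 3} := by
  obtain ⟨w, hw, hw𝔐⟩ := one_sub_natCast_eq_three_mul h𝔐 h3 hq
  have hq9 : (q : integralClosure ℤ ℂ) =
      9 * ((q / 9 : ℕ) : integralClosure ℤ ℂ) + ((q % 9 : ℕ) : integralClosure ℤ ℂ) := by
    exact_mod_cast (Nat.div_add_mod q 9).symm
  have hne : 𝔐 ≠ ⊤ := h𝔐.ne_top
  obtain ⟨w', hw', hw'𝔐⟩ : ∃ w' : integralClosure ℤ ℂ,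
      (1 + (q : integralClosure ℤ ℂ) + (q : integralClosure ℤ ℂ) ^ 2) = 3 * w' ∧ w' ∉ 𝔐 := by
    set m : integralClosure ℤ ℂ := ((q / 9 : ℕ) : integralClosure ℤ ℂ) with hm
    rcases hq with h | h
    · refine ⟨27 * m ^ 2 + 27 * m + 7, ?_, ?_⟩
      · rw [hq9, h]; push_cast; ring
      · intro hmem
        have h27 : 27 * m ^ 2 + 27 * m ∈ 𝔐 := by
          have : 27 * m ^ 2 + 27 * m = 3 * (9 * m ^ 2 + 9 * m) := by ring
          rw [this]; exact Ideal.mul_mem_right _ 𝔐 h3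
        have h7 : (7 : integralClosure ℤ ℂ) ∈ 𝔐 := by simpa using Ideal.sub_mem 𝔐 hmem h27
        have h6 : (6 : integralClosure ℤ ℂ) ∈ 𝔐 := by
          have : (6 : integralClosure ℤ ℂ) = 3 * 2 := by norm_num
          rw [this]; exact Ideal.mul_mem_right _ 𝔐 h3
        apply hne; rw [Ideal.eq_top_iff_one]
        have := Ideal.sub_mem 𝔐 h7 h6
        norm_num at this
        exact this
    · refine ⟨27 * m ^ 2 + 45 * m + 19, ?_, ?_⟩
      · rw [hq9, h]; push_cast; ring
      · intro hmem
        have h27 : 27 * m ^ 2 + 45 * m ∈ 𝔐 := by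
          have : 27 * m ^ 2 + 45 * m = 3 * (9 * m ^ 2 + 15 * m) := by ring
          rw [this]; exact Ideal.mul_mem_right _ 𝔐 h3
        have h19 : (19 : integralClosure ℤ ℂ) ∈ 𝔐 := by simpa using Ideal.sub_mem 𝔐 hmem h27
        have h18 : (18 : integralClosure ℤ ℂ) ∈ 𝔐 := by
          have : (18 : integralClosure ℤ ℂ) = 3 * 6 := by norm_num
          rw [this]; exact Ideal.mul_mem_right _ 𝔐 h3
        apply hne; rw [Ideal.eq_top_iff_one]
        have := Ideal.sub_mem 𝔐 h19 h18
        norm_num at this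
        exact this
  have hprod : a * w * w' ∉ 𝔐 := by
    intro h
    rcases h𝔐.mem_or_mem h with h1 | h1
    · exact (h𝔐.mem_or_mem h1).elim ha hw𝔐
    · exact hw'𝔐 h1
  have : a * (1 - (q : integralClosure ℤ ℂ) ^ 3) = 3 ^ 2 * (a * w * w') := by
    have hfac : (1 - (q : integralClosure ℤ ℂ) ^ 3) =
        (1 - (q : integralClosure ℤ ℂ)) *
          (1 + (q : integralClosure ℤ ℂ) + (q : integralClosure ℤ ℂ) ^ 2) := by
      ring
    rw [hfac, hw, hw']; ring
  rw [this]
  exact not_cong_succ_three_pow_mul h𝔐 h3 hprod 2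

end Summit.Langlands.Langlands.Theorems.MuOrdinaryFamilyRT.Negative
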